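import Literature.Barriers.CriticalPhenomena.SAPColumnClasses
import Literature.Barriers.CriticalPhenomena.SAPAnisotropicNotDFiniteProofs
import Mathlib.RingTheory.Polynomial.Cyclotomic.Basic
import HarnessLib

/-!
# Rechnitzer's Theorem 1 for self-avoiding polygons, proved (haruspicy, layer 5)

Companion of `SAPAnisotropicNotDFinite`, which vendors A. Rechnitzer, *Haruspicy 2* (J. Combin.
Theory Ser. A 113 (2006); arXiv:math/0406450v2), Theorem 1 (from Rechnitzer 2003): every row
`H_n(x) = Σ_m p_{m,n} x^m` of the anisotropic generating function of square-lattice self-avoiding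
polygons "is a rational function", "the degree of the numerator of `H_n(x)` cannot be greater
than the degree of its denominator", and "the denominator of `H_n(x)` is a product of cyclotomic
polynomials" — the named fact `Rechnitzer2006_thm1`. This file DISCHARGES it:
`Rechnitzer2006_thm1_holds`.

The proof is the haruspicy argument of the source, §2.1 (reduction to finitely many minimal
polygons, "`H_n(x)` may be written as the sum of simple rational functions"), carried out with
the coarser column-level reduction of `SAPSections` / `SAPColumnClasses` (which suffices for
Theorem 1, though not for the sharper denominator bounds of the source's Theorem 6):
by `card_canonWords_eq_sum`, `p_{m,n} = Σ_{w} #{t : gaps w → ℕ₊ | Σ_g k_g(w) t_g = m}` over the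
finitely many column-minimal canonical words `w` with `2n` vertical bonds, whence
`H_n = Σ_w ∏_{g ∈ gaps w} F_{k_g(w)}` with `F_k = Σ_{t ≥ 1} X^{kt}` (`sapRowGF_eq_sum`); since
`(X^k - 1) F_k = -X^k` and `X^k - 1 = ∏_{d ∣ k} Ψ_d` (Mathlib's
`Polynomial.prod_cyclotomic_eq_X_pow_sub_one`), the common denominator
`D = ∏_w ∏_g (X^{k_g} - 1)` is a product of cyclotomic polynomials, `D · H_n` is a polynomial,
and each summand `(∏_g -X^{k_g}) · ∏_{w' ≠ w} D_{w'}` has degree `deg D`.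

Consequence (with `SAPAnisotropicNotDFiniteProofs`, which proves Theorem 15 and the reduction
`Rechnitzer2006_cor27_of_thm1_thm16`): the barrier `SAPAnisotropicNotDFinite` = Corollary 27 now
rests on the single named fact `Rechnitzer2006_thm16` (`Rechnitzer2006_cor27_of_thm16`,
`sapAnisotropicNotDFinite_of_thm16`).

## References

* A. Rechnitzer, *Haruspicy 2: The anisotropic generating function of self-avoiding polygons is
  not D-finite*, J. Combin. Theory Ser. A 113 (2006) 520–546, Theorem 1 and §2.1.
  [Rechnitzer2006Haruspicy2]
-/

noncomputable section

open Finset PowerSeries Literature.Probability.LatticeModels Literature.Probability.Percolation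
open scoped BigOperators

namespace Literature.Barriers.CriticalPhenomena

namespace Haruspicy

open Edwards2D

/-! ### The rows of `P(x,y)` count canonical words -/

/-- The coefficients of `H_n` are the numbers of canonical words. [folklore] -/
theorem coeff_sapRowGF (n m : ℕ) :
    coeff m (sapRowGF ℚ n) = ((canonWords (2 * (m + n)) (2 * m)).card : ℚ) := by
  rw [sapRowGF, coeff_mk, polygonCount_eq_card_canonWords]

/-! ### The geometric series `F_k = Σ_{t ≥ 1} X^{kt}` -/

/-- `F_k = Σ_{t ≥ 1} X^{kt}`, the generating function of one gap of crossing number `k`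
stretched to all positive widths. [folklore] -/
def geomGF (k : ℕ) : PowerSeries ℚ :=
  PowerSeries.mk fun j => if k ∣ j ∧ 0 < j then 1 else 0

/-- Coefficients of `F_k`. [folklore] -/
theorem coeff_geomGF (k j : ℕ) : coeff j (geomGF k) = if k ∣ j ∧ 0 < j then 1 else 0 := by
  rw [geomGF, coeff_mk]

/-- The truncation `Σ_{t=1}^{m} X^{kt}` of `F_k` agrees with it up to degree `m` (`k ≥ 1`).
[folklore] -/
theorem coeff_geomGF_eq_coeff_trunc {k : ℕ} (hk : 1 ≤ k) {m j : ℕ} (hj : j ≤ m) :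
    coeff j (geomGF k) = coeff j (∑ t ∈ Finset.Icc 1 m, (X : PowerSeries ℚ) ^ (k * t)) := by
  rw [coeff_geomGF, map_sum (coeff (R := ℚ) j)]
  simp only [coeff_X_pow]
  by_cases h : k ∣ j ∧ 0 < j
  · rw [if_pos h]
    obtain ⟨⟨t, rfl⟩, hpos⟩ := h
    have ht : 1 ≤ t := by
      rcases Nat.eq_zero_or_pos t with rfl | h
      · simp at hpos
      · exact h
    have htm : t ≤ m := le_trans (by nlinarith) hj
    rw [Finset.sum_eq_single_of_mem t (Finset.mem_Icc.2 ⟨ht, htm⟩)]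
    · simp
    · intro b _ hb
      rw [if_neg]
      intro h'
      exact hb (Nat.eq_of_mul_eq_mul_left hk h'.symm)
  · rw [if_neg h]
    symm
    refine Finset.sum_eq_zero fun t ht => ?_
    rw [Finset.mem_Icc] at ht
    rw [if_neg]
    rintro rfl
    exact h ⟨⟨t, rfl⟩, Nat.mul_pos hk ht.1⟩

/-- A product of differences divisible by `d` differs from the product by a multiple of `d`.
[folklore] -/
theorem dvd_prod_sub_prod {ι R : Type*} [CommRing R] [DecidableEq ι] (s : Finset ι) (f f' : ι → R)
    (d : R) (h : ∀ i ∈ s, d ∣ f i - f' i) : d ∣ ∏ i ∈ s, f i - ∏ i ∈ s, f' i := by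
  induction s using Finset.induction_on with
  | empty => simp
  | insert a s ha ih =>
    rw [Finset.prod_insert ha, Finset.prod_insert ha,
      show f a * ∏ i ∈ s, f i - f' a * ∏ i ∈ s, f' i =
        f a * (∏ i ∈ s, f i - ∏ i ∈ s, f' i) + (f a - f' a) * ∏ i ∈ s, f' i by ring]
    exact dvd_add (dvd_mul_of_dvd_right (ih fun i hi => h i (Finset.mem_insert_of_mem hi)) _)
      (dvd_mul_of_dvd_left (h a (Finset.mem_insert_self a s)) _)

/-- **Coefficients of a product of geometric series**: the coefficient of `X^m` in
`∏_{g ∈ G} F_{k_g}` (`k ≥ 1` on `G`) counts the width vectors `t : G → [1, m]` with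
`Σ_g k_g t_g = m`. [folklore] -/
theorem coeff_prod_geomGF {G : Finset ℤ} {k : ℤ → ℕ} (hk : ∀ g ∈ G, 1 ≤ k g) (m : ℕ) :
    coeff m (∏ g ∈ G, geomGF (k g)) =
      (((Fintype.piFinset fun _ : ↥G => Finset.Icc 1 m).filter
        fun t => ∑ g : ↥G, k g.1 * t g = m).card : ℚ) := by
  classical
  -- replace each factor by its truncation
  have htrunc : coeff m (∏ g ∈ G, geomGF (k g)) =
      coeff m (∏ g ∈ G, ∑ t ∈ Finset.Icc 1 m, (X : PowerSeries ℚ) ^ (k g * t)) := by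
    have hd := dvd_prod_sub_prod G (fun g => geomGF (k g))
      (fun g => ∑ t ∈ Finset.Icc 1 m, (X : PowerSeries ℚ) ^ (k g * t)) (X ^ (m + 1)) fun g hg => by
        rw [X_pow_dvd_iff]
        intro j hj
        rw [map_sub, coeff_geomGF_eq_coeff_trunc (hk g hg) (Nat.lt_succ_iff.1 hj), sub_self]
    rw [X_pow_dvd_iff] at hd
    have := hd m (Nat.lt_succ_self m)
    rw [map_sub, sub_eq_zero] at this
    exact this
  rw [htrunc, ← Finset.prod_coe_sort G, Finset.prod_univ_sum]
  simp only [Finset.prod_pow_eq_pow_sum, map_sum, coeff_X_pow]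
  rw [Finset.sum_boole]
  congr 2
  ext t
  simp only [Finset.mem_filter, eq_comm]

/-! ### The rows as sums of products of geometric series -/

/-- **`H_n` as a sum of simple rational functions**:
`H_n = Σ_{w ∈ colMinWords n} ∏_{g ∈ gaps w} F_{k_g(w)}` (proved; the column-level analogue of
the decomposition over section-minimal polygons in the source).
[cite: Rechnitzer2006Haruspicy2, §2.1 (after Lemma 5)] -/
theorem sapRowGF_eq_sum (n : ℕ) :
    sapRowGF ℚ n = ∑ w ∈ colMinWords n, ∏ g ∈ gaps w, geomGF (kgap w g) := by
  ext m
  rw [coeff_sapRowGF, card_canonWords_eq_sum, map_sum, Nat.cast_sum]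
  refine Finset.sum_congr rfl fun w hw => ?_
  rw [mem_colMinWords] at hw
  rw [coeff_prod_geomGF (fun g hg => one_le_kgap hw.1.1.2.1 hg)]
  rfl

/-- The geometric series shifted: `F_k = X^k (1 + F_k)`. [folklore] -/
theorem geomGF_eq {k : ℕ} (hk : 1 ≤ k) : geomGF k = X ^ k * (1 + geomGF k) := by
  ext j
  rw [coeff_X_pow_mul', map_add, coeff_geomGF, coeff_geomGF, coeff_one]
  by_cases hkj : k ≤ j
  · rw [if_pos hkj]
    rcases hkj.lt_or_eq with hlt | rfl
    · rw [if_neg (show ¬(j - k = 0) by omega)]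
      have hiff : k ∣ j - k ↔ k ∣ j := by
        constructor
        · intro h
          have := Nat.dvd_add h (dvd_refl k)
          rwa [Nat.sub_add_cancel hlt.le] at this
        · intro h
          exact (Nat.dvd_sub_iff_right hlt.le h).2 (dvd_refl k)
      by_cases hd : k ∣ j
      · rw [if_pos (show k ∣ j ∧ 0 < j from ⟨hd, by omega⟩),
          if_pos (show k ∣ j - k ∧ 0 < j - k from ⟨hiff.2 hd, by omega⟩), zero_add]
      · rw [if_neg (show ¬(k ∣ j ∧ 0 < j) from fun h => hd h.1),
          if_neg (show ¬(k ∣ j - k ∧ 0 < j - k) from fun h => hd (hiff.1 h.1)), zero_add]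
    · rw [Nat.sub_self, if_pos (show k ∣ k ∧ 0 < k from ⟨dvd_refl k, hk⟩), if_pos rfl,
        if_neg (show ¬(k ∣ 0 ∧ 0 < 0) from fun h => (lt_irrefl 0 h.2)), add_zero]
  · rw [if_neg hkj, if_neg]
    rintro ⟨⟨c, rfl⟩, hpos⟩
    rcases Nat.eq_zero_or_pos c with rfl | hc
    · simp at hpos
    · exact hkj (Nat.le_mul_of_pos_right k hc)

/-- **Clearing one gap**: `(X^k - 1) · F_k = -X^k` (`k ≥ 1`). [folklore] -/
theorem X_pow_sub_one_mul_geomGF {k : ℕ} (hk : 1 ≤ k) :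
    ((Polynomial.X ^ k - 1 : Polynomial ℚ) : PowerSeries ℚ) * geomGF k =
      ((-Polynomial.X ^ k : Polynomial ℚ) : PowerSeries ℚ) := by
  rw [Polynomial.coe_sub, Polynomial.coe_pow, Polynomial.coe_X, Polynomial.coe_one,
    Polynomial.coe_neg, Polynomial.coe_pow, Polynomial.coe_X]
  have h := geomGF_eq hk
  linear_combination (-1 : PowerSeries ℚ) * h

/-! ### Assembly of Theorem 1 -/

/-- The denominator attached to one column-minimal word: `D_w = ∏_{g ∈ gaps w} (X^{k_g} - 1)`.
[folklore] -/
def denomOf (w : List (Fin 4)) : Polynomial ℚ :=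
  ∏ g ∈ gaps w, (Polynomial.X ^ kgap w g - 1)

/-- The numerator attached to one column-minimal word: `N_w = ∏_{g ∈ gaps w} (-X^{k_g})`.
[folklore] -/
def numerOf (w : List (Fin 4)) : Polynomial ℚ :=
  ∏ g ∈ gaps w, (-Polynomial.X ^ kgap w g)

/-- The multiset of cyclotomic indices of `H_n`: all divisors of all crossing numbers `k_g(w)`,
`w` column-minimal with `2n` vertical bonds, `g` a gap of `w`. [folklore] -/
def cycIndices (n : ℕ) : Multiset ℕ :=
  (colMinWords n).val.bind fun w => (gaps w).val.bind fun g => (kgap w g).divisors.val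

variable {n : ℕ}

/-- `D_w · ∏_g F_{k_g} = N_w` in `ℚ⟦x⟧`. [folklore] -/
theorem denomOf_mul_prod_geomGF {w : List (Fin 4)} (hw : w ∈ colMinWords n) :
    (denomOf w : PowerSeries ℚ) * ∏ g ∈ gaps w, geomGF (kgap w g) = (numerOf w : PowerSeries ℚ) := by
  rw [mem_colMinWords] at hw
  rw [denomOf, numerOf, ← Polynomial.coeToPowerSeries.ringHom_apply, map_prod,
    ← Polynomial.coeToPowerSeries.ringHom_apply, map_prod, ← Finset.prod_mul_distrib]
  refine Finset.prod_congr rfl fun g hg => ?_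
  rw [Polynomial.coeToPowerSeries.ringHom_apply, Polynomial.coeToPowerSeries.ringHom_apply]
  exact X_pow_sub_one_mul_geomGF (one_le_kgap hw.1.1.2.1 hg)

/-- The product of the cyclotomic polynomials indexed by `cycIndices n` is the common
denominator `∏_w D_w`. [folklore] -/
theorem prod_cyclotomic_cycIndices (n : ℕ) :
    ((cycIndices n).map fun k => Polynomial.cyclotomic k ℚ).prod =
      ∏ w ∈ colMinWords n, denomOf w := by
  rw [cycIndices, Multiset.map_bind, Multiset.prod_bind, Finset.prod_eq_multiset_prod]
  congr 1
  refine Multiset.map_congr rfl fun w hw => ?_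
  rw [Multiset.map_bind, Multiset.prod_bind, denomOf, Finset.prod_eq_multiset_prod]
  congr 1
  refine Multiset.map_congr rfl fun g hg => ?_
  rw [← Finset.prod_eq_multiset_prod,
    Polynomial.prod_cyclotomic_eq_X_pow_sub_one (one_le_kgap (mem_colMinWords.1 hw).1.1.2.1 hg)]

/-- `D_w` is monic of degree `Σ_g k_g`. [folklore] -/
theorem natDegree_denomOf {w : List (Fin 4)} (hw : w ∈ colMinWords n) :
    (denomOf w).Monic ∧ (denomOf w).natDegree = ∑ g ∈ gaps w, kgap w g := by
  rw [mem_colMinWords] at hw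
  have hmon : ∀ g ∈ gaps w, (Polynomial.X ^ kgap w g - 1 : Polynomial ℚ).Monic := by
    intro g hg
    rw [← Polynomial.C_1]
    exact Polynomial.monic_X_pow_sub_C _ (by have := one_le_kgap hw.1.1.2.1 hg; omega)
  refine ⟨Polynomial.monic_prod_of_monic _ _ hmon, ?_⟩
  rw [denomOf, Polynomial.natDegree_prod_of_monic _ _ hmon]
  refine Finset.sum_congr rfl fun g _ => ?_
  rw [← Polynomial.C_1, Polynomial.natDegree_X_pow_sub_C]

/-- `N_w` has degree at most `Σ_g k_g`. [folklore] -/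
theorem natDegree_numerOf_le (w : List (Fin 4)) :
    (numerOf w).natDegree ≤ ∑ g ∈ gaps w, kgap w g := by
  rw [numerOf]
  refine (Polynomial.natDegree_prod_le _ _).trans (Finset.sum_le_sum fun g _ => ?_)
  rw [Polynomial.natDegree_neg, Polynomial.natDegree_X_pow]

end Haruspicy

open Haruspicy in
/-- **Rechnitzer 2006, Theorem 1, PROVED** (discharge of the named fact `Rechnitzer2006_thm1`):
for every `n`, the row `H_n(x) = Σ_m p_{m,n} x^m` of the anisotropic generating function of
self-avoiding polygons on `ℤ²` satisfies `D · H_n = N` with `D` a product of cyclotomic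
polynomials and `deg N ≤ deg D`. Proof by haruspicy at the level of columns: `H_n` is the finite
sum, over the column-minimal polygons `w` with `2n` vertical bonds, of
`∏_{g} X^{k_g}/(1 - X^{k_g})` (`sapRowGF_eq_sum`); take `D = ∏_w ∏_g (X^{k_g} - 1) = ∏ Ψ_d`.
[cite: Rechnitzer2006Haruspicy2, Theorem 1] -/
theorem Rechnitzer2006_thm1_holds : Rechnitzer2006_thm1 := by
  classical
  intro n
  refine ⟨∑ w ∈ colMinWords n, numerOf w * ∏ w' ∈ (colMinWords n).erase w, denomOf w',
    cycIndices n, ?_, ?_⟩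
  · -- degrees
    rw [prod_cyclotomic_cycIndices,
      Polynomial.natDegree_prod_of_monic _ _ fun w hw => (natDegree_denomOf hw).1]
    refine Polynomial.natDegree_sum_le_of_forall_le _ _ fun w hw => ?_
    refine Polynomial.natDegree_mul_le.trans ?_
    rw [← Finset.sum_erase_add _ _ hw]
    have hN : (numerOf w).natDegree ≤ (denomOf w).natDegree :=
      (natDegree_numerOf_le w).trans (natDegree_denomOf hw).2.ge
    have hP : (∏ w' ∈ (colMinWords n).erase w, denomOf w').natDegree ≤
        ∑ x ∈ (colMinWords n).erase w, (denomOf x).natDegree :=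
      Polynomial.natDegree_prod_le _ _
    omega
  · -- the identity `D · H_n = N`
    rw [prod_cyclotomic_cycIndices, sapRowGF_eq_sum, Finset.mul_sum]
    have hrhs : ((∑ w ∈ colMinWords n, numerOf w * ∏ w' ∈ (colMinWords n).erase w, denomOf w' :
        Polynomial ℚ) : PowerSeries ℚ) = ∑ w ∈ colMinWords n, ((numerOf w : PowerSeries ℚ) *
          ((∏ w' ∈ (colMinWords n).erase w, denomOf w' : Polynomial ℚ) : PowerSeries ℚ)) := by
      rw [← Polynomial.coeToPowerSeries.ringHom_apply, map_sum]
      simp only [map_mul, Polynomial.coeToPowerSeries.ringHom_apply]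
    rw [hrhs]
    refine Finset.sum_congr rfl fun w hw => ?_
    rw [← Finset.mul_prod_erase _ _ hw, Polynomial.coe_mul, mul_right_comm,
      denomOf_mul_prod_geomGF hw]

/-- **Corollary 27 from Theorem 16 alone**: with Theorem 1 proved, Rechnitzer's Corollary 27
(the anisotropic SAP generating function is not D-finite in `y`) follows from the named fact
`Rechnitzer2006_thm16` (simple poles of `H_{3k-2}` at the primitive `k`-th roots of unity) via
`Rechnitzer2006_cor27_of_thm1_thm16`. [cite: Rechnitzer2006Haruspicy2, Corollary 27] -/
theorem Rechnitzer2006_cor27_of_thm16 (h16 : Rechnitzer2006_thm16) : Rechnitzer2006_cor27 :=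
  Rechnitzer2006_cor27_of_thm1_thm16 Rechnitzer2006_thm1_holds h16

/-- The barrier `SAPAnisotropicNotDFinite` from the single named fact `Rechnitzer2006_thm16`.
[cite: Rechnitzer2006Haruspicy2, Corollary 27] -/
theorem sapAnisotropicNotDFinite_of_thm16 (h16 : Rechnitzer2006_thm16) : SAPAnisotropicNotDFinite :=
  Rechnitzer2006_cor27_of_thm16 h16

end Literature.Barriers.CriticalPhenomena
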